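import Summits.RiemannHypothesis.RiemannHypothesis.Theorems.WeilFormatCFarAssembly
import HarnessLib

/-!
# GRH arm (rh-explicit, venture WeilGRH): the archimedean kernel is `⪰ diag(2e⁻)` on the FAR MODES of `ℤ` — the
  sector-free (ℤ-level) far coercivity needed by COMPLEX characters

Cell `rh-explicit`, WEIL TRACK — GRH ARM (lit/typing seat weil-grh-5 gen11).  For a complex character the Gram kernel
`twistedGramCoeffC χ a` is hermitian but NOT reflection-invariant, so the even/odd sector split of weil-2/weil-10 is not
available and a format-C certificate must work on all modes `|n| ≤ N` at once (door
`weilPositivityOnChar_of_twistedGramCoeffC_realify_any`, weil-grh-1).  Its far-coercivity input (L-C3a) is therefore needed at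
the level of `modes N ⊆ ℤ`.  The ARCHIMEDEAN kernel `archCoeff a` is real and reflection-symmetric, so weil-10's two SECTOR far
bounds (`evenArch_far_ge_diag`, `oddArch_far_ge_diag_atan`, `WeilFormatCArchFarBound.lean`) recombine through weil-2's sector
decomposition `sum_modes_mul_mul_eq_sectors` into ONE bound for every real (then complex) vector supported on the far modes
`B ≤ |p| ≤ N` (`2 ≤ B`, block `M₁ = B − 1` in both sectors):

* `archCoeff_modes_far_ge` — `Σ_{p∈modes N} 2e⁻_B(|p|) x_p² ≤ Σ_{p,q∈modes N} x_p x_q archCoeff a p q` (real `x`),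
* `re_archCoeff_modes_far_ge` — `Σ_{p∈modes N} 2e⁻_B(|p|) ‖c_p‖² ≤ Re Σ_{p,q} conj(c_p) c_q archCoeff a p q` (complex `c`),

with the odd-sector (smaller) weight `e⁻_B(n) = ½(Re ψ(¼+iω_n/2) − log π) − 1/(8n) − c_R/n² − ½(π/2 − arctan(√(B−1)/√n)) − c_R√(8/(B−1))`
(`c_R = a(1+E)/π²`, `E = weilArchDensity(2a)`; the factor `2` converts weil-2's M-units to the orthonormal `χ_n`).
Sequel `TwistedFarComplex.lean` adds the complex prime block (`⪰ −A_op⁺`, modulus shift bound) and the conductor.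
Standard axioms; no definitions; no named facts; RH/GRH-free.
-/

set_option autoImplicit false

noncomputable section

open Complex Finset
open scoped Real BigOperators ComplexConjugate ArithmeticFunction.vonMangoldt

namespace Summit.Ventures.WeilGRH

open Literature.NumberTheory.LFunctions
open Literature.NumberTheory.LFunctions.Yoshida1992 (modes freq archCoeff)
open Literature.Analysis.SpecialFunctions
open Summit.RiemannHypothesis.RiemannHypothesis.Theorems.WeilFormatC

variable {a : ℝ}

/-- The even far weight dominates the odd (arctan) one: `e⁺(n) − e⁻(n) = ½(π/2 − arctan(√M₁/√n)) ≥ 0`. -/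
theorem hilbert_atan_penalty_nonneg (M₁ n : ℕ) : 0 ≤ (π / 2 - Real.arctan (Real.sqrt M₁ / Real.sqrt (n : ℝ))) / 2 := by
  have h := Real.arctan_lt_pi_div_two (Real.sqrt M₁ / Real.sqrt (n : ℝ))
  linarith

/-- **The archimedean kernel on the far modes (real vectors).**  For `a > 0`, `2 ≤ B` and a real `x : ℤ → ℝ` supported on
`B ≤ |p| ≤ N`:  `Σ_{p∈modes N} 2e⁻_B(|p|) x_p² ≤ Σ_{p,q∈modes N} x_p x_q archCoeff a p q`. -/
theorem archCoeff_modes_far_ge (ha : 0 < a) {B : ℕ} (hB : 2 ≤ B) (N : ℕ) (x : ℤ → ℝ)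
    (hxB : ∀ p : ℤ, p.natAbs < B → x p = 0) (hxN : ∀ p : ℤ, N < p.natAbs → x p = 0) :
    ∑ p ∈ modes N, 2 * ((reDigammaQuarter (freq a p.natAbs) - Real.log π) / 2 - 1 / (8 * (p.natAbs : ℝ))
          - a * (1 + weilArchDensity (2 * a)) / (π ^ 2 * (p.natAbs : ℝ) ^ 2)
          - (π / 2 - Real.arctan (Real.sqrt ((B - 1 : ℕ) : ℝ) / Real.sqrt (p.natAbs : ℝ))) / 2
          - a * (1 + weilArchDensity (2 * a)) / π ^ 2 * Real.sqrt (8 / ((B - 1 : ℕ) : ℝ))) * x p ^ 2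
      ≤ ∑ p ∈ modes N, ∑ q ∈ modes N, x p * x q * archCoeff a p q := by
  have hB1 : 1 ≤ B - 1 := by omega
  set M₁ := B - 1 with hM₁
  -- weights
  set ep : ℕ → ℝ := fun n ↦ (reDigammaQuarter (freq a n) - Real.log π) / 2
      - a * (1 + weilArchDensity (2 * a)) / (π ^ 2 * n ^ 2) - 1 / (8 * n)
      - a * (1 + weilArchDensity (2 * a)) / π ^ 2 * Real.sqrt (8 / M₁) with hep
  set em : ℕ → ℝ := fun n ↦ (reDigammaQuarter (freq a n) - Real.log π) / 2 - 1 / (8 * n)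
      - a * (1 + weilArchDensity (2 * a)) / (π ^ 2 * n ^ 2) - (π / 2 - Real.arctan (Real.sqrt M₁ / Real.sqrt n)) / 2
      - a * (1 + weilArchDensity (2 * a)) / π ^ 2 * Real.sqrt (8 / M₁) with hem
  have hle : ∀ n : ℕ, em n ≤ ep n := fun n ↦ by
    simp only [hep, hem]
    have := hilbert_atan_penalty_nonneg M₁ n
    linarith
  -- the folds
  set y : ℕ → ℝ := fun n ↦ if n = 0 then x 0 else x n + x (-(n : ℤ)) with hy
  set u : ℕ → ℝ := fun n ↦ x n - x (-(n : ℤ)) with hu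
  have hx0 : x 0 = 0 := hxB 0 (by simp; omega)
  have hy0 : ∀ n : ℕ, n < B → y n = 0 := fun n hn ↦ by
    simp only [hy]
    split_ifs with h
    · exact hx0
    · rw [hxB n (by simpa using hn), hxB (-(n : ℤ)) (by simpa using hn), add_zero]
  have hu0 : ∀ n : ℕ, n < B → u n = 0 := fun n hn ↦ by
    simp only [hu]
    rw [hxB n (by simpa using hn), hxB (-(n : ℤ)) (by simpa using hn), sub_zero]
  have hyN : ∀ n : ℕ, N < n → y n = 0 := fun n hn ↦ by
    simp only [hy]
    split_ifs with h
    · exact hx0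
    · rw [hxN n (by simpa using hn), hxN (-(n : ℤ)) (by simpa using hn), add_zero]
  have huN : ∀ n : ℕ, N < n → u n = 0 := fun n hn ↦ by
    simp only [hu]
    rw [hxN n (by simpa using hn), hxN (-(n : ℤ)) (by simpa using hn), sub_zero]
  -- sector decomposition of the form
  rw [sum_modes_mul_mul_eq_sectors (archCoeff a) (archCoeff_neg_neg a) N x]
  -- EVEN part ≥ Σ_{Ioc M₁ N} ep y²
  have heven : ∑ n ∈ Finset.Ioc M₁ N, ep n * y n ^ 2
      ≤ ∑ n ∈ Finset.range (N + 1), ∑ m ∈ Finset.range (N + 1),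
        (if n = 0 then x 0 else x n + x (-(n : ℤ))) * (if m = 0 then x 0 else x m + x (-(m : ℤ))) *
          (if n = 0 then archCoeff a 0 m else if m = 0 then archCoeff a n 0
            else (archCoeff a n m + archCoeff a n (-(m : ℤ))) / 2) := by
    have h := evenArch_far_ge_diag ha (M₁ := M₁) hB1 N y
    refine (le_of_eq ?_).trans (h.trans (le_of_eq ?_))
    · rfl
    · -- restrict the range sums to `Ico B (N+1) = Ioc M₁ N`
      have hIco : Finset.Ico B (N + 1) = Finset.Ioc M₁ N := by
        rw [Ico_eq_Ioc_pred (by omega : 1 ≤ B) (N + 1)]; rfl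
      rw [← hIco]
      symm
      rw [sum_range_eq_sum_Ico (B := B) (N := N + 1) _ (fun n hn ↦ ?_)]
      · refine Finset.sum_congr rfl fun n hn ↦ ?_
        have hn1 : 1 ≤ n := le_trans (by omega) (Finset.mem_Ico.mp hn).1
        rw [sum_range_eq_sum_Ico (B := B) (N := N + 1) _ (fun m hm ↦ ?_)]
        · refine Finset.sum_congr rfl fun m hm ↦ ?_
          have hm1 : 1 ≤ m := le_trans (by omega) (Finset.mem_Ico.mp hm).1
          rw [evenKernel_of_pos _ hn1 hm1]
          ring
        · have : y m = 0 := by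
            rcases Nat.lt_or_ge m B with h1 | h1
            · exact hy0 m h1
            · exact hyN m (by omega)
          have e : (if m = 0 then x 0 else x m + x (-(m : ℤ))) = y m := rfl
          rw [e, this]; ring
      · have : y n = 0 := by
          rcases Nat.lt_or_ge n B with h1 | h1
          · exact hy0 n h1
          · exact hyN n (by omega)
        refine Finset.sum_eq_zero fun m _ ↦ ?_
        have e : (if n = 0 then x 0 else x n + x (-(n : ℤ))) = y n := rfl
        rw [e, this]; ring
  -- ODD part ≥ Σ_{Ioc M₁ N} em u²
  have hodd : ∑ n ∈ Finset.Ioc M₁ N, em n * u n ^ 2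
      ≤ ∑ k ∈ Finset.range N, ∑ l ∈ Finset.range N,
        (x ((k : ℤ) + 1) - x (-((k : ℤ) + 1))) * (x ((l : ℤ) + 1) - x (-((l : ℤ) + 1))) *
          ((archCoeff a ((k : ℤ) + 1) ((l : ℤ) + 1) - archCoeff a ((k : ℤ) + 1) (-((l : ℤ) + 1))) / 2) := by
    have h := oddArch_far_ge_diag_atan ha (M₁ := M₁) hB1 N u
    refine (le_of_eq ?_).trans (h.trans (le_of_eq ?_))
    · rfl
    · -- reindex `k = n − 1`: range N ⊇ Ico M₁ N ↔ Ioc M₁ N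
      have hk : ∀ k : ℕ, (x ((k : ℤ) + 1) - x (-((k : ℤ) + 1))) = u (k + 1) := fun k ↦ by
        simp only [hu]; push_cast; ring_nf
      symm
      rw [sum_range_eq_sum_Ico (B := M₁) (N := N) _ (fun k hk' ↦ ?_)]
      · rw [← sum_Ico_succ_eq_sum_Ioc M₁ N]
        refine Finset.sum_congr rfl fun k _ ↦ ?_
        rw [sum_range_eq_sum_Ico (B := M₁) (N := N) _ (fun l hl' ↦ ?_)]
        · rw [← sum_Ico_succ_eq_sum_Ioc M₁ N]
          refine Finset.sum_congr rfl fun l _ ↦ ?_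
          rw [hk k, hk l]
          push_cast
          ring
        · have : u (l + 1) = 0 := by
            rcases Nat.lt_or_ge (l + 1) B with h1 | h1
            · exact hu0 _ h1
            · exact huN _ (by omega)
          rw [hk l, this]; ring
      · have : u (k + 1) = 0 := by
          rcases Nat.lt_or_ge (k + 1) B with h1 | h1
          · exact hu0 _ h1
          · exact huN _ (by omega)
        refine Finset.sum_eq_zero fun l _ ↦ ?_
        rw [hk k, this]; ring
  -- weights: Σ_modes 2 em(|p|) x_p² = Σ_{Ioc M₁ N} em n (y n² + u n²) ≤ Σ ep y² + Σ em u²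
  have hw : ∑ p ∈ modes N, 2 * em p.natAbs * x p ^ 2 = ∑ n ∈ Finset.Ioc M₁ N, em n * (y n ^ 2 + u n ^ 2) := by
    rw [sum_modes_eq]
    simp only [Int.natAbs_zero, Int.natAbs_neg]
    have hk : ∀ k : ℕ, ((k : ℤ) + 1).natAbs = k + 1 := fun k ↦ by
      rw [show ((k : ℤ) + 1) = ((k + 1 : ℕ) : ℤ) by push_cast; ring, Int.natAbs_natCast]
    simp_rw [hk]
    rw [hx0]
    simp only [ne_eq, OfNat.ofNat_ne_zero, not_false_eq_true, zero_pow, mul_zero, zero_add]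
    rw [← sum_Ico_succ_eq_sum_Ioc M₁ N]
    symm
    rw [← sum_range_eq_sum_Ico (B := M₁) (N := N)
      (fun k ↦ em (k + 1) * (y (k + 1) ^ 2 + u (k + 1) ^ 2)) (fun k hk' ↦ ?_)]
    · refine Finset.sum_congr rfl fun k _ ↦ ?_
      simp only [hy, hu, Nat.succ_ne_zero, if_false]
      push_cast
      ring
    · have h1 : y (k + 1) = 0 ∧ u (k + 1) = 0 := by
        rcases Nat.lt_or_ge (k + 1) B with h1 | h1
        · exact ⟨hy0 _ h1, hu0 _ h1⟩
        · exact ⟨hyN _ (by omega), huN _ (by omega)⟩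
      rw [h1.1, h1.2]; ring
  have hw' : ∑ p ∈ modes N, 2 * ((reDigammaQuarter (freq a p.natAbs) - Real.log π) / 2 - 1 / (8 * (p.natAbs : ℝ))
          - a * (1 + weilArchDensity (2 * a)) / (π ^ 2 * (p.natAbs : ℝ) ^ 2)
          - (π / 2 - Real.arctan (Real.sqrt ((B - 1 : ℕ) : ℝ) / Real.sqrt (p.natAbs : ℝ))) / 2
          - a * (1 + weilArchDensity (2 * a)) / π ^ 2 * Real.sqrt (8 / ((B - 1 : ℕ) : ℝ))) * x p ^ 2
      = ∑ p ∈ modes N, 2 * em p.natAbs * x p ^ 2 :=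
    Finset.sum_congr rfl fun p _ ↦ by simp only [hem, hM₁]
  rw [hw', hw]
  have hsplit : ∑ n ∈ Finset.Ioc M₁ N, em n * (y n ^ 2 + u n ^ 2)
      ≤ ∑ n ∈ Finset.Ioc M₁ N, ep n * y n ^ 2 + ∑ n ∈ Finset.Ioc M₁ N, em n * u n ^ 2 := by
    rw [← Finset.sum_add_distrib]
    refine Finset.sum_le_sum fun n _ ↦ ?_
    have := mul_le_mul_of_nonneg_right (hle n) (sq_nonneg (y n))
    linarith
  exact hsplit.trans (add_le_add heven hodd)

/-- **The archimedean kernel on the far modes (complex vectors).**  For `a > 0`, `2 ≤ B` and `c : ℤ → ℂ` supported on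
`B ≤ |p| ≤ N`:  `Σ_{p∈modes N} 2e⁻_B(|p|) ‖c_p‖² ≤ Re Σ_{p,q∈modes N} conj(c_p) c_q archCoeff a p q`. -/
theorem re_archCoeff_modes_far_ge (ha : 0 < a) {B : ℕ} (hB : 2 ≤ B) (N : ℕ) (c : ℤ → ℂ)
    (hcB : ∀ p : ℤ, p.natAbs < B → c p = 0) (hcN : ∀ p : ℤ, N < p.natAbs → c p = 0) :
    ∑ p ∈ modes N, 2 * ((reDigammaQuarter (freq a p.natAbs) - Real.log π) / 2 - 1 / (8 * (p.natAbs : ℝ))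
          - a * (1 + weilArchDensity (2 * a)) / (π ^ 2 * (p.natAbs : ℝ) ^ 2)
          - (π / 2 - Real.arctan (Real.sqrt ((B - 1 : ℕ) : ℝ) / Real.sqrt (p.natAbs : ℝ))) / 2
          - a * (1 + weilArchDensity (2 * a)) / π ^ 2 * Real.sqrt (8 / ((B - 1 : ℕ) : ℝ))) * ‖c p‖ ^ 2
      ≤ (∑ p ∈ modes N, ∑ q ∈ modes N, conj (c p) * c q * (archCoeff a p q : ℂ)).re := by
  have hx := archCoeff_modes_far_ge ha hB N (fun p ↦ (c p).re)
    (fun p hp ↦ by rw [hcB p hp, Complex.zero_re]) (fun p hp ↦ by rw [hcN p hp, Complex.zero_re])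
  have hy := archCoeff_modes_far_ge ha hB N (fun p ↦ (c p).im)
    (fun p hp ↦ by rw [hcB p hp, Complex.zero_im]) (fun p hp ↦ by rw [hcN p hp, Complex.zero_im])
  have hre : (∑ p ∈ modes N, ∑ q ∈ modes N, conj (c p) * c q * (archCoeff a p q : ℂ)).re
      = (∑ p ∈ modes N, ∑ q ∈ modes N, (c p).re * (c q).re * archCoeff a p q)
        + ∑ p ∈ modes N, ∑ q ∈ modes N, (c p).im * (c q).im * archCoeff a p q := by
    rw [Complex.re_sum, ← Finset.sum_add_distrib]
    refine Finset.sum_congr rfl fun p _ ↦ ?_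
    rw [Complex.re_sum, ← Finset.sum_add_distrib]
    refine Finset.sum_congr rfl fun q _ ↦ ?_
    simp only [Complex.mul_re, Complex.mul_im, Complex.conj_re, Complex.conj_im, Complex.ofReal_re,
      Complex.ofReal_im]
    ring
  have hnorm : ∀ p : ℤ, ‖c p‖ ^ 2 = (c p).re ^ 2 + (c p).im ^ 2 := fun p ↦ by
    rw [Complex.sq_norm, Complex.normSq_apply]; ring
  have hl : ∑ p ∈ modes N, 2 * ((reDigammaQuarter (freq a p.natAbs) - Real.log π) / 2 - 1 / (8 * (p.natAbs : ℝ))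
          - a * (1 + weilArchDensity (2 * a)) / (π ^ 2 * (p.natAbs : ℝ) ^ 2)
          - (π / 2 - Real.arctan (Real.sqrt ((B - 1 : ℕ) : ℝ) / Real.sqrt (p.natAbs : ℝ))) / 2
          - a * (1 + weilArchDensity (2 * a)) / π ^ 2 * Real.sqrt (8 / ((B - 1 : ℕ) : ℝ))) * ‖c p‖ ^ 2
      = (∑ p ∈ modes N, 2 * ((reDigammaQuarter (freq a p.natAbs) - Real.log π) / 2 - 1 / (8 * (p.natAbs : ℝ))
          - a * (1 + weilArchDensity (2 * a)) / (π ^ 2 * (p.natAbs : ℝ) ^ 2)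
          - (π / 2 - Real.arctan (Real.sqrt ((B - 1 : ℕ) : ℝ) / Real.sqrt (p.natAbs : ℝ))) / 2
          - a * (1 + weilArchDensity (2 * a)) / π ^ 2 * Real.sqrt (8 / ((B - 1 : ℕ) : ℝ))) * (c p).re ^ 2)
        + ∑ p ∈ modes N, 2 * ((reDigammaQuarter (freq a p.natAbs) - Real.log π) / 2 - 1 / (8 * (p.natAbs : ℝ))
          - a * (1 + weilArchDensity (2 * a)) / (π ^ 2 * (p.natAbs : ℝ) ^ 2)
          - (π / 2 - Real.arctan (Real.sqrt ((B - 1 : ℕ) : ℝ) / Real.sqrt (p.natAbs : ℝ))) / 2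
          - a * (1 + weilArchDensity (2 * a)) / π ^ 2 * Real.sqrt (8 / ((B - 1 : ℕ) : ℝ))) * (c p).im ^ 2 := by
    rw [← Finset.sum_add_distrib]
    exact Finset.sum_congr rfl fun p _ ↦ by rw [hnorm]; ring
  rw [hl, hre]
  exact add_le_add hx hy

end Summit.Ventures.WeilGRH

end
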